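import Literature.Barriers.BirchSwinnertonDyer.RankNotSumOfLocalInvariantsK41Data
import Literature.Barriers.BirchSwinnertonDyer.RankNotSumOfLocalInvariants480a1Dyadic
import Literature.Barriers.BirchSwinnertonDyer.RankNotSumOfLocalInvariantsDescentNeg1
import Literature.Barriers.BirchSwinnertonDyer.RankNotSumOfLocalInvariants480a1
import HarnessLib

/-!
# `rk E(F₄)` for `E = 480a1`: the `2`-descent over `ℚ(√41)`, II — `rk E(ℚ(√41)) ≤ 1`

The upper bound `hU41` of `descent_480a1_F4_of_upper_bounds`
(`RankNotSumOfLocalInvariantsF4TwistsQ.lean`) for the rank leaf `rk E(F₄) = 6` of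
T. Dokchitser–V. Dokchitser, *A note on the Mordell–Weil rank modulo n*, J. Number Theory 131 (2011),
proof of Thm. 2 (`E = 480a1`, `F₄ = ℚ(√-1, √41, √73)`; "2-descent … over all minimal non-trivial
subfields"):

* `mordellWeilRank_K41_le_one : (curve480a1.baseChange K).mordellWeilRank ≤ 1`, `K = ℚ(√41)`.

This is a COMPLETE `2`-DESCENT OVER THE NUMBER FIELD `ℚ(√41)` (Silverman, *AEC*, Prop. X.1.4),
in the linear form of the tree's descents over `ℚ` (`DescentNeg1`): the coordinates character
`ψ = (s⁺, s⁻, a⁺, a⁻, a₃)(x) ⊕ (a⁺, a⁻, b⁺, b⁻)(x + 2) : E(K) → 𝔽₂⁹` (signs at the two real places,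
parities at `𝔭₂, 𝔭₂'` through the embeddings `ι± : K → ℚ₂`, at the inert prime `(3)` through the
norm, at `𝔭₅, 𝔭₅'` through `κ± : K → ℚ₅`; part I, `RankNotSumOfLocalInvariantsK41Data.lean`)

* has kernel in `2E(K)`: the omitted bits `s±(x + 2)`, `a₃(x + 2)`, `b±(x)` vanish on every point
  by the local conditions, so a point in the kernel has all fourteen structural bits of
  `(x, x + 2)` trivial, and then `x`, `x + 2` are squares by the square theorem
  (`Sqrt41.exists_sq_eq_of_local_data`: `h_K = 1`, totally positive units are squares, and the
  dictionary between the primes above `2, 3, 5` and `ι±`, the norm, `κ±`);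
* has image in the `8`-element solution set `TK41` of the local conditions at `∞±` (sign of
  `x + 2`), `𝔭₂, 𝔭₂'` (the dyadic conditions of `E` over `ℚ₂`, `dyadic_conditions_480a1`, pulled
  back along `ι±`), `(3)` and `𝔭₅, 𝔭₅'` (`OddPlace.local_conditions_of_mult` for the inert place
  and the pulled-back `5`-adic places), the seven non-structural characters being expressed in
  the nine coordinates by the character sum over the basis `-1, ε, π₂, 2, 3, π₅, 5` of `K(S, 2)`
  (`Row_eq`); `#TK41 = 8` by `decide`;

whence `2^{r+2} ≤ 8` by the counting lemma `mordellWeilRank_le_of_range_subset` (Mordell–Weil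
over `K`). The `2`-Selmer group of `E/ℚ(√41)` has order `8` (this computation), so the bound is
sharp: `rk E(ℚ(√41)) = rk E(ℚ) + rk E^{(41)}(ℚ) = 1 + 0`.

## References

* T. Dokchitser, V. Dokchitser, *A note on the Mordell–Weil rank modulo n*, J. Number Theory 131
  (2011) 1833–1839, proof of Thm. 2. [DokchitserDokchitser2011RankModN]
* J. H. Silverman, *The Arithmetic of Elliptic Curves*, 2nd ed., GTM 106 (2009), Prop. X.1.4,
  Example X.1.5, Thm. X.1.1(c). [SilvermanAEC2009]
-/

noncomputable section

open scoped Classical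

open NumberField QuadraticAlgebra IsDedekindDomain IsDedekindDomain.HeightOneSpectrum WithZero
open WeierstrassCurve WeierstrassCurve.Affine WeierstrassCurve.Affine.Point
open Literature.NumberTheory.QuadraticFields.Sqrt41
open Literature.NumberTheory.NumberFields
open Literature.NumberTheory.EllipticCurves
open Literature.NumberTheory.EllipticCurves.TwoDescentLocal
open Literature.NumberTheory.EllipticCurves.KramerTwoDescent

attribute [-instance] instDecidableEqQuadraticAlgebra

namespace Literature.Barriers.BirchSwinnertonDyer

namespace DokchitserDokchitser2011

namespace K41D

/-! ### Characters of the descent components over a general field -/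

section Chars

variable {F : Type*} [Field F] [CharZero F] {W : Affine F} [W.IsElliptic] {e₁ e₂ e₃ : F}

/-- `χ ∘ δ₁` for a character `χ` of `Fˣ/Fˣ²` (general field; the tree's `charFst` is `F = ℚ`).
[folklore] -/
def charFstF (h : W.SplitTwoTorsion e₁ e₂ e₃) (χ : Additive (SqUnits F) →+ ZMod 2) :
    W.Point →+ ZMod 2 :=
  χ.comp ((MonoidHom.toAdditive (MonoidHom.fst (SqUnits F) (SqUnits F))).comp (twoDescentMap h))

/-- `χ ∘ δ₂`. [folklore] -/
def charSndF (h : W.SplitTwoTorsion e₁ e₂ e₃) (χ : Additive (SqUnits F) →+ ZMod 2) :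
    W.Point →+ ZMod 2 :=
  χ.comp ((MonoidHom.toAdditive (MonoidHom.snd (SqUnits F) (SqUnits F))).comp (twoDescentMap h))

/-- `(χ ∘ δ₁)(P) = χ(δ₁ P)`. [folklore] -/
theorem charFstF_apply (h : W.SplitTwoTorsion e₁ e₂ e₃) (χ : Additive (SqUnits F) →+ ZMod 2)
    (P : W.Point) : charFstF h χ P = χ (Additive.ofMul (twoDescentComponent W e₁ e₂ e₃ P)) := by
  simp [charFstF, twoDescentMap_apply]

/-- `(χ ∘ δ₂)(P) = χ(δ₂ P)`. [folklore] -/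
theorem charSndF_apply (h : W.SplitTwoTorsion e₁ e₂ e₃) (χ : Additive (SqUnits F) →+ ZMod 2)
    (P : W.Point) : charSndF h χ P = χ (Additive.ofMul (twoDescentComponent W e₂ e₁ e₃ P)) := by
  simp [charSndF, twoDescentMap_apply]

end Chars

/-! ### The curve over `K` -/

/-- `E = 480a1` over `K = ℚ(√41)` (local notation). -/
local notation "EK" => WeierstrassCurve.baseChange curve480a1 K

/-- `E/K` is an elliptic curve. [folklore] -/
instance isElliptic_EK : (EK).IsElliptic := curve480a1.isElliptic_baseChange K

/-- Rational `2`-torsion `0, -2, 3` of `E` over `K`. [folklore] -/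
theorem splitTwoTorsion_K : (EK).toAffine.SplitTwoTorsion 0 (-2) 3 where
  b₂_eq := by
    rw [show (EK).toAffine.b₂ = (EK).b₂ from rfl, WeierstrassCurve.b₂,
      show (EK).a₁ = 0 from curve480a1.baseChange_a₁ K, show (EK).a₂ = -1 from curve480a1.baseChange_a₂ K]
    norm_num
  b₄_eq := by
    rw [show (EK).toAffine.b₄ = (EK).b₄ from rfl, WeierstrassCurve.b₄,
      show (EK).a₁ = 0 from curve480a1.baseChange_a₁ K, show (EK).a₃ = 0 from curve480a1.baseChange_a₃ K,
      show (EK).a₄ = -6 from curve480a1.baseChange_a₄ K]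
    norm_num
  b₆_eq := by
    rw [show (EK).toAffine.b₆ = (EK).b₆ from rfl, WeierstrassCurve.b₆,
      show (EK).a₃ = 0 from curve480a1.baseChange_a₃ K, show (EK).a₆ = 0 from curve480a1.baseChange_a₆ K]
    norm_num

/-- The equation of `E` over `K` in product form. [folklore] -/
theorem equation_K {x y : K} (hP : (EK).toAffine.Nonsingular x y) : y ^ 2 = x * (x + 2) * (x - 3) := by
  have h := (curve480a1.nonsingular_iff K x y).mp hP
  rw [h]; ring

/-- On `E/K`, `y = 0` forces `x ∈ {0, -2, 3}`. [folklore] -/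
theorem x_eq_of_y_eq_zero_K {x : K} (hP : (EK).toAffine.Nonsingular x 0) : x = 0 ∨ x = -2 ∨ x = 3 := by
  have h := equation_K hP
  rw [zero_pow two_ne_zero, zero_eq_mul, mul_eq_zero] at h
  rcases h with (h | h) | h
  · exact Or.inl h
  · exact Or.inr (Or.inl (by linear_combination h))
  · exact Or.inr (Or.inr (by linear_combination h))

/-! ### Valuations outside `S` of the descent components of a `K`-point -/

/-- For a `K`-point `(x, y)`, `y ≠ 0`: `x` and `x + 2` have even valuation at every prime of `𝓞 K`
not above `30` (Silverman AEC Thm. X.1.1(c), tree `two_dvd_log_valuation_twoDescent`).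
[cite: SilvermanAEC2009, Thm. X.1.1(c)] -/
theorem hS_point {x y : K} (hP : (EK).toAffine.Nonsingular x y) (hy : y ≠ 0) :
    (∀ v : HeightOneSpectrum (𝓞 K), (30 : 𝓞 K) ∉ v.asIdeal → (2 : ℤ) ∣ log (v.valuation K x)) ∧
    (∀ v : HeightOneSpectrum (𝓞 K), (30 : 𝓞 K) ∉ v.asIdeal → (2 : ℤ) ∣ log (v.valuation K (x + 2))) := by
  have hE : y ^ 2 = (x - 0) * (x - (-2)) * (x - 3) := by rw [equation_K hP]; ring
  have h₀ : x * (x + 2) * (x - 3) ≠ 0 := (equation_K hP) ▸ pow_ne_zero 2 hy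
  have hx : x ≠ 0 := fun h0 => h₀ (by rw [h0, zero_mul, zero_mul])
  have hx₂ : x ≠ -2 := fun h0 => h₀ (by rw [h0]; ring)
  have hS : ∀ v ∉ {v : HeightOneSpectrum (𝓞 K) | (30 : 𝓞 K) ∈ v.asIdeal},
      v.valuation K (0 : K) ≤ 1 ∧ v.valuation K (-2 : K) ≤ 1 ∧ v.valuation K (3 : K) ≤ 1 ∧
      v.valuation K ((0 : K) - (-2)) = 1 ∧ v.valuation K ((0 : K) - 3) = 1 ∧
      v.valuation K ((-2 : K) - 3) = 1 := by
    intro v hv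
    simp only [Set.mem_setOf_eq] at hv
    obtain ⟨-, -, -, g2, g3, -, g5⟩ := valuation_gens v hv
    refine ⟨by simp, ?_, g3.le, ?_, ?_, ?_⟩
    · rw [Valuation.map_neg]; exact g2.le
    · rw [show (0 : K) - (-2) = 2 by ring]; exact g2
    · rw [show (0 : K) - 3 = -3 by ring, Valuation.map_neg]; exact g3
    · rw [show (-2 : K) - 3 = -5 by ring, Valuation.map_neg]; exact g5
  constructor
  · intro v hv
    have h := (two_dvd_log_valuation_twoDescent (R := 𝓞 K) hS hE v hv).1 hx
    rwa [sub_zero] at h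
  · intro v hv
    have h := (two_dvd_log_valuation_twoDescent (R := 𝓞 K) hS hE v hv).2.1 hx₂
    rwa [sub_neg_eq_add] at h

/-! ### The local conditions for a `K`-point -/

/-- Real points: `X (X + 2) (X - 3) > 0` forces `X + 2 > 0`. [folklore] -/
theorem pos_add_two {X : ℝ} (h : 0 < X * (X + 2) * (X - 3)) : 0 < X + 2 := by
  by_contra hle
  push Not at hle
  have h1 : X ≤ 0 := by linarith
  have h2 : X - 3 ≤ 0 := by linarith
  have h3 : 0 ≤ X * (X + 2) := mul_nonneg_of_nonpos_of_nonpos h1 hle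
  have : X * (X + 2) * (X - 3) ≤ 0 := mul_nonpos_of_nonneg_of_nonpos h3 h2
  linarith

/-- `v₅(2) = v₅(-3) = 0`, `v₅(-5) = 1`, `pχ 5 (-2) = 1`. [folklore] -/
theorem five_constants : (2 : ℚ_[5]).valuation = 0 ∧ (-3 : ℚ_[5]).valuation = 0 ∧
    (-5 : ℚ_[5]).valuation = 1 ∧ pχ 5 (-2 : ℚ_[5]) = 1 := by
  have hv : ∀ {q : ℤ}, ¬ (5 : ℤ) ∣ q → ((q : ℚ) : ℚ_[5]).valuation = 0 := fun hq => by
    rw [Padic.valuation_ratCast, padicValRat.of_int, padicValInt.eq_zero_of_not_dvd hq]; rfl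
  refine ⟨?_, ?_, ?_, ?_⟩
  · have := hv (q := 2) (by decide); exact_mod_cast this
  · have := hv (q := -3) (by decide); exact_mod_cast this
  · rw [show (-5 : ℚ_[5]) = -(5 : ℚ_[5]) by ring, valuation_neg'', valuation_five']
  · rw [show (-2 : ℚ_[5]) = ((-2 : ℚ) : ℚ_[5]) by norm_num, pχ_ratCast,
      show (-2 : ℚ) = (-1) * 2 by norm_num, qrBit_mul 5 (by norm_num) (by norm_num),
      qrBit_five_values.1, qrBit_five_values.2.1, zero_add]

/-- `ord_(3)` of `-2, -5` is `0`, of `-3` is `1`; `x₃(2) = 0`. [folklore] -/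
theorem three_constants : 𝔳3.v (-2 : K) = 0 ∧ 𝔳3.v (-5 : K) = 0 ∧ 𝔳3.v (-3 : K) = 1 ∧
    𝔳3.χ (2 : K) = 0 := by
  haveI : Fact (Nat.Prime 3) := ⟨Nat.prime_three⟩
  have hv : ∀ {q : ℤ}, ¬ (3 : ℤ) ∣ q → padicValRat 3 (q : ℚ) = 0 := fun hq => by
    rw [padicValRat.of_int, padicValInt.eq_zero_of_not_dvd hq]; rfl
  have e1 : (-2 : K).norm = 4 := by rw [norm_def]; norm_num [re_ofNat, im_ofNat]
  have e2 : (-5 : K).norm = 25 := by rw [norm_def]; norm_num [re_ofNat, im_ofNat]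
  have e3 : (-3 : K).norm = 9 := by rw [norm_def]; norm_num [re_ofNat, im_ofNat]
  refine ⟨?_, ?_, ?_, x3_values.2.2.2.1⟩
  · show padicValRat 3 (-2 : K).norm / 2 = 0
    rw [e1, show (4 : ℚ) = ((4 : ℤ) : ℚ) by norm_num, hv (by decide)]; rfl
  · show padicValRat 3 (-5 : K).norm / 2 = 0
    rw [e2, show (25 : ℚ) = ((25 : ℤ) : ℚ) by norm_num, hv (by decide)]; rfl
  · show padicValRat 3 (-3 : K).norm / 2 = 1
    rw [e3, show (9 : ℚ) = ((3 : ℕ) : ℚ) ^ 2 by norm_num, padicValRat.pow, padicValRat.self (by norm_num)]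
    rfl

/-- **The local conditions of the `2`-descent of `E` over `K = ℚ(√41)` at `∞±, 𝔭₂, 𝔭₂', (3),
𝔭₅, 𝔭₅'`**, for a `K`-point `(x, y)` with `y ≠ 0`, in terms of the bits of `x` and `x + 2`:
real places (`σ±(x + 2) > 0`), dyadic places (`dyadic_conditions_480a1` through `ι±`), the
inert place `(3)` and the places above `5` (`OddPlace.local_conditions_of_mult`).
[cite: SilvermanAEC2009, Prop. X.1.4] -/
theorem point_conditions {x y : K} (hP : (EK).toAffine.Nonsingular x y) (hy : y ≠ 0) :
    (bP x = 0 ∧ bN x = 0 ∧ sP (x + 2) = 0 ∧ sN (x + 2) = 0 ∧ a3 (x + 2) = 0) ∧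
    (aP (x + 2) = aP x ∧ aN (x + 2) = aN x) ∧
    (c4P (x + 2) = 0 ∧ c8P (x + 2) = c8P x + aP x ∧ c4N (x + 2) = 0 ∧ c8N (x + 2) = c8N x + aN x) ∧
    (x3 (x + 2) = 0 ∧ qP x = bP (x + 2) ∧ qN x = bN (x + 2)) := by
  haveI : Fact (Nat.Prime 3) := ⟨Nat.prime_three⟩
  have hE := equation_K hP
  -- transport of the equation along the embeddings
  have hmap : ∀ {A : Type} [Field A] [Algebra ℚ A] (τ : K →ₐ[ℚ] A),
      (τ y) ^ 2 = τ x * (τ x + 2) * (τ x - 3) := by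
    intro A _ _ τ
    have := congrArg τ hE
    rw [map_pow, map_mul, map_mul, map_add, map_sub, map_ofNat, map_ofNat] at this
    exact this
  have hadd : ∀ {A : Type} [Field A] [Algebra ℚ A] (τ : K →ₐ[ℚ] A), τ x + 2 = τ (x + 2) := by
    intro A _ _ τ; rw [map_add, map_ofNat]
  -- dyadic conditions through `ι±`
  obtain ⟨dP1, dP2, dP3⟩ := dyadic_conditions_480a1 ((map_ne_zero ιpos).mpr hy) (hmap ιpos)
  obtain ⟨dN1, dN2, dN3⟩ := dyadic_conditions_480a1 ((map_ne_zero ιneg).mpr hy) (hmap ιneg)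
  rw [hadd] at dP1 dP2 dP3 dN1 dN2 dN3
  -- real conditions through `σ±`
  have real : ∀ (τ : K →ₐ[ℚ] ℝ), rsign (τ (x + 2)) = 0 := by
    intro τ
    have hτy : τ y ≠ 0 := (map_ne_zero τ).mpr hy
    have hpos : 0 < τ x * (τ x + 2) * (τ x - 3) := by rw [← hmap τ]; positivity
    have h2 := pos_add_two hpos
    rw [hadd] at h2
    exact (rsign_eq_zero_iff h2.ne').mpr h2
  -- the inert place `(3)`, isolated root `e₁ = -2`
  obtain ⟨t1, t2, t3, t4⟩ := three_constants
  have h3 := OddPlace.local_conditions_of_mult (𝔳 := 𝔳3) (e₁ := (-2 : K)) (e₂ := 0) (e₃ := 3)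
    (x := x) (y := y) (by rw [sub_zero]; exact t1) (by rw [show (-2 : K) - 3 = -5 by ring]; exact t2)
    (by rw [show (0 : K) - 3 = -3 by ring]; exact t3) (by norm_num) (by norm_num) (by norm_num) hy
    (by rw [hE]; ring)
  rw [sub_neg_eq_add, sub_zero, show (0 : K) - (-2) = 2 by ring, t4, mul_zero] at h3
  obtain ⟨h3a, h3b⟩ := h3
  -- the places above `5`, isolated root `e₁ = 0`, through `κ±`
  obtain ⟨f2, f3, f5, fq⟩ := five_constants
  have h5 : ∀ (τ : K →ₐ[ℚ] ℚ_[5]), Even (τ x).valuation ∧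
      pχ 5 (τ x) = (((τ (x + 2)).valuation : ℤ) : ZMod 2) := by
    intro τ
    have h := OddPlace.local_conditions_of_mult (𝔳 := (padicPlace 5).comap τ.toRingHom)
      (e₁ := (0 : K)) (e₂ := -2) (e₃ := 3) (x := x) (y := y)
      (by rw [OddPlace.comap_v, padicPlace_v, show (0 : K) - (-2) = 2 by ring]
          change (τ 2).valuation = 0; rw [map_ofNat]; exact f2)
      (by rw [OddPlace.comap_v, padicPlace_v, show (0 : K) - 3 = -3 by ring]
          change (τ (-3)).valuation = 0; rw [map_neg, map_ofNat]; exact f3)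
      (by rw [OddPlace.comap_v, padicPlace_v, show (-2 : K) - 3 = -5 by ring]
          change (τ (-5)).valuation = 1; rw [map_neg, map_ofNat]; exact f5)
      (by norm_num) (by norm_num) (by norm_num) hy (by rw [hE]; ring)
    rw [sub_zero, sub_neg_eq_add, show (-2 : K) - 0 = -2 by ring] at h
    obtain ⟨ha, hb⟩ := h
    rw [OddPlace.comap_v, padicPlace_v] at ha
    rw [OddPlace.comap_χ, OddPlace.comap_χ, OddPlace.comap_parity, padicPlace_χ, padicPlace_χ,
      padicPlace_parity] at hb
    change Even (τ x).valuation at ha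
    change pχ 5 (τ x) = (((τ (x + 2)).valuation : ℤ) : ZMod 2) * pχ 5 (τ (-2)) at hb
    refine ⟨ha, ?_⟩
    rw [hb, map_neg, map_ofNat, fq, mul_one]
  obtain ⟨h5Pa, h5Pb⟩ := h5 κpos
  obtain ⟨h5Na, h5Nb⟩ := h5 κneg
  -- parity conversions
  have hev0 : ∀ {n : ℤ}, Even n → (n : ZMod 2) = 0 := fun h =>
    (ZMod.intCast_zmod_eq_zero_iff_dvd _ 2).mpr (even_iff_two_dvd.mp h)
  refine ⟨⟨hev0 h5Pa, hev0 h5Na, real σpos, real σneg, (𝔳3.parity_eq_zero_iff _).mpr h3a⟩,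
    ⟨dP1.symm, dN1.symm⟩, ⟨dP2, ?_, dN2, ?_⟩, ⟨h3b, h5Pb, h5Nb⟩⟩
  · rw [c8P, dP3]; rfl
  · rw [c8N, dN3]; rfl

/-! ### Coordinates, the conditions `CK` and the target set `TK` -/

/-- The five coordinates `(s⁺, s⁻, a⁺, a⁻, a₃)` of the first descent component. [folklore] -/
abbrev VU : Type := ZMod 2 × ZMod 2 × ZMod 2 × ZMod 2 × ZMod 2
/-- The four coordinates `(a⁺, a⁻, b⁺, b⁻)` of the second descent component. [folklore] -/
abbrev VW : Type := ZMod 2 × ZMod 2 × ZMod 2 × ZMod 2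
/-- The coordinate space `𝔽₂⁹` of `ψ`. [folklore] -/
abbrev V9 : Type := VU × VW

/-- `(s⁺, s⁻, a⁺, a⁻, a₃)(z)`. [folklore] -/
def coordU (z : K) : VU :=
  ((Bits z).1, (Bits z).2.1, (Bits z).2.2.1, (Bits z).2.2.2.1, (Bits z).2.2.2.2.1)

/-- `(a⁺, a⁻, b⁺, b⁻)(z)`. [folklore] -/
def coordW (z : K) : VW :=
  ((Bits z).2.2.1, (Bits z).2.2.2.1, (Bits z).2.2.2.2.2.1, (Bits z).2.2.2.2.2.2)

/-- The row of local character values of a class with exponents `n` (the value table). [folklore] -/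
def rowOf (n : V7) : V7 :=
  n.1 • ((1, 0, 1, 0, 0, 0, 0) : V7) + n.2.1 • ((0, 0, 1, 0, 1, 1, 1) : V7) +
    n.2.2.1 • ((0, 1, 0, 1, 1, 0, 1) : V7) + n.2.2.2.1 • ((0, 0, 0, 0, 0, 1, 1) : V7) +
    n.2.2.2.2.1 • ((1, 1, 1, 1, 0, 1, 1) : V7) + n.2.2.2.2.2.1 • ((1, 1, 0, 0, 0, 1, 1) : V7) +
    n.2.2.2.2.2.2 • ((0, 1, 0, 1, 0, 0, 0) : V7)

/-- `Row z = rowOf (ex (Bits z))` (the character sum, `Row_eq`). [folklore] -/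
theorem Row_eq_rowOf (z : K) (hz : z ≠ 0)
    (hS : ∀ v : HeightOneSpectrum (𝓞 K), (30 : 𝓞 K) ∉ v.asIdeal → (2 : ℤ) ∣ log (v.valuation K z)) :
    Row z = rowOf (ex (Bits z)) := Row_eq z hz hS

/-- Exponents of a first component: its bits are `(U, 0, 0)` (`b± = 0`). [folklore] -/
def exU (U : VU) : V7 := ex (U.1, U.2.1, U.2.2.1, U.2.2.2.1, U.2.2.2.2, 0, 0)

/-- Exponents of a second component: its bits are `(0, 0, a⁺, a⁻, 0, b⁺, b⁻)`. [folklore] -/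
def exW (W : VW) : V7 := ex (0, 0, W.1, W.2.1, 0, W.2.2.1, W.2.2.2)

/-- **The nine remaining local conditions** on `(U, W) ∈ 𝔽₂⁹` (the five identically vanishing bits
being built in): `a±(x + 2) = a±(x)`; `c4±(x + 2) = 0`, `c8±(x + 2) = c8±(x) + a±(x)` (dyadic);
`x₃(x + 2) = 0` (inert `3`); `q±(x) = b±(x + 2)` (above `5`), the characters being read off the
value table through the exponents. [folklore] -/
def CK (p : V9) : Prop :=
  p.2.1 = p.1.2.2.1 ∧ p.2.2.1 = p.1.2.2.2.1 ∧
  (rowOf (exW p.2)).1 = 0 ∧ (rowOf (exW p.2)).2.1 = (rowOf (exU p.1)).2.1 + p.1.2.2.1 ∧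
  (rowOf (exW p.2)).2.2.1 = 0 ∧ (rowOf (exW p.2)).2.2.2.1 = (rowOf (exU p.1)).2.2.2.1 + p.1.2.2.2.1 ∧
  (rowOf (exW p.2)).2.2.2.2.1 = 0 ∧
  (rowOf (exU p.1)).2.2.2.2.2.1 = p.2.2.2.1 ∧ (rowOf (exU p.1)).2.2.2.2.2.2 = p.2.2.2.2

/-- `CK` is decidable. [folklore] -/
instance decCK : DecidablePred CK := fun p => by
  unfold CK; exact inferInstance

/-- The target set: the `8` solutions in `𝔽₂⁹` of the local conditions. [folklore] -/
def TK : Finset V9 := Finset.univ.filter fun p => CK p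

set_option maxRecDepth 100000 in
/-- `#TK = 8`. [folklore] -/
theorem card_TK : TK.card = 8 := by decide

/-- **Every `K`-point with `y ≠ 0` satisfies the local conditions** `CK` in coordinates.
[cite: SilvermanAEC2009, Prop. X.1.4] -/
theorem cK_coord {x y : K} (hP : (EK).toAffine.Nonsingular x y) (hy : y ≠ 0) :
    CK (coordU x, coordW (x + 2)) := by
  have hE := equation_K hP
  have h₀ : x * (x + 2) * (x - 3) ≠ 0 := hE ▸ pow_ne_zero 2 hy
  have hx : x ≠ 0 := fun h0 => h₀ (by rw [h0, zero_mul, zero_mul])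
  have hx₂ : x + 2 ≠ 0 := fun h0 => h₀ (by rw [h0, mul_zero, zero_mul])
  obtain ⟨hSu, hSw⟩ := hS_point hP hy
  obtain ⟨⟨b1, b2, s1, s2, z3⟩, ⟨a1, a2⟩, ⟨c1, c2, c3, c4⟩, ⟨t1, q1, q2⟩⟩ := point_conditions hP hy
  have hBu : Bits x = (sP x, sN x, aP x, aN x, a3 x, 0, 0) := by
    simp only [Bits, b1, b2]
  have hBw : Bits (x + 2) = (0, 0, aP (x + 2), aN (x + 2), 0, bP (x + 2), bN (x + 2)) := by
    simp only [Bits, s1, s2, z3]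
  have eU : rowOf (exU (coordU x)) = Row x := by
    rw [Row_eq_rowOf x hx hSu, exU, coordU, hBu]
  have eW : rowOf (exW (coordW (x + 2))) = Row (x + 2) := by
    rw [Row_eq_rowOf (x + 2) hx₂ hSw, exW, coordW, hBw]
  unfold CK
  rw [eU, eW]
  simp only [coordU, coordW, hBu, hBw, Row]
  exact ⟨a1, a2, c1, c2, c3, c4, t1, q1, q2⟩

/-! ### The coordinates character `ψ : E(K) → 𝔽₂⁹` -/

/-- The structural bits as characters of `Kˣ/Kˣ²`. [folklore] -/
def sPHom : Additive (SqUnits K) →+ ZMod 2 := bitHom sP fun h1 h2 => sP_mul h1 h2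
/-- see `sPHom`. [folklore] -/
def sNHom : Additive (SqUnits K) →+ ZMod 2 := bitHom sN fun h1 h2 => sN_mul h1 h2
/-- see `sPHom`. [folklore] -/
def aPHom : Additive (SqUnits K) →+ ZMod 2 := bitHom aP fun h1 h2 => aP_mul h1 h2
/-- see `sPHom`. [folklore] -/
def aNHom : Additive (SqUnits K) →+ ZMod 2 := bitHom aN fun h1 h2 => aN_mul h1 h2
/-- see `sPHom`. [folklore] -/
def a3Hom : Additive (SqUnits K) →+ ZMod 2 := bitHom a3 fun h1 h2 => a3_mul h1 h2
/-- see `sPHom`. [folklore] -/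
def bPHom : Additive (SqUnits K) →+ ZMod 2 := bitHom bP fun h1 h2 => bP_mul h1 h2
/-- see `sPHom`. [folklore] -/
def bNHom : Additive (SqUnits K) →+ ZMod 2 := bitHom bN fun h1 h2 => bN_mul h1 h2

/-- **The coordinates character** `ψ = (s⁺, s⁻, a⁺, a⁻, a₃) ∘ δ₁ ⊕ (a⁺, a⁻, b⁺, b⁻) ∘ δ₂` of
`E(K)`, `δ = (x, x + 2)`. [folklore] -/
def ψ9 : (EK).toAffine.Point →+ V9 :=
  ((charFstF splitTwoTorsion_K sPHom).prod ((charFstF splitTwoTorsion_K sNHom).prod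
    ((charFstF splitTwoTorsion_K aPHom).prod ((charFstF splitTwoTorsion_K aNHom).prod
      (charFstF splitTwoTorsion_K a3Hom))))).prod
  ((charSndF splitTwoTorsion_K aPHom).prod ((charSndF splitTwoTorsion_K aNHom).prod
    ((charSndF splitTwoTorsion_K bPHom).prod (charSndF splitTwoTorsion_K bNHom))))

/-- `ψ` on a point of `E(K)`: the coordinates of the classes `δ₁, δ₂` of the two descent
components, for any non-zero representatives `u, w`. [folklore] -/
theorem ψ9_of_components {P : (EK).toAffine.Point} {u w : K} (hu : u ≠ 0) (hw : w ≠ 0)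
    (h₁ : twoDescentComponent (EK).toAffine 0 (-2) 3 P = sqClass u)
    (h₂ : twoDescentComponent (EK).toAffine (-2) 0 3 P = sqClass w) :
    ψ9 P = (coordU u, coordW w) := by
  simp only [ψ9, AddMonoidHom.prod_apply, charFstF_apply, charSndF_apply, h₁, h₂, sPHom, sNHom, aPHom,
    aNHom, a3Hom, bPHom, bNHom, bitHom_sqClass _ _ hu, bitHom_sqClass _ _ hw, coordU, coordW, Bits]

/-- `ψ` on a point with `x ≠ 0, -2`: the coordinates of `x` and `x + 2`. [folklore] -/
theorem ψ9_some {x y : K} (hP : (EK).toAffine.Nonsingular x y) (hx₁ : x ≠ 0) (hx₂ : x ≠ -2) :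
    ψ9 (.some _ _ hP) = (coordU x, coordW (x + 2)) := by
  refine ψ9_of_components hx₁ (by rw [← sub_neg_eq_add]; exact sub_ne_zero.mpr hx₂) ?_ ?_
  · rw [twoDescentComponent_some_of_ne hP hx₁, sub_zero]
  · rw [twoDescentComponent_some_of_ne hP hx₂, sub_neg_eq_add]

/-- Bits of the descent values at the `2`-torsion: `-6, 2` (`x = 0`), `-2, 10` (`x = -2`),
`3, 5` (`x = 3`). [folklore] -/
theorem coord_torsion :
    coordU (((0 : K) - (-2)) * (0 - 3)) = (1, 1, 1, 1, 1) ∧ coordW ((0 : K) - (-2)) = (1, 1, 0, 0) ∧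
    coordU ((-2 : K) - 0) = (1, 1, 1, 1, 0) ∧ coordW (((-2 : K) - 0) * (-2 - 3)) = (1, 1, 1, 1) ∧
    coordU ((3 : K) - 0) = (0, 0, 0, 0, 1) ∧ coordW ((3 : K) - (-2)) = (0, 0, 1, 1) := by
  obtain ⟨m1, -, -, m2, m3, -, m5⟩ := Bits_values
  have h2 : (2 : K) ≠ 0 := by norm_num
  have h3 : (3 : K) ≠ 0 := by norm_num
  have h5 : (5 : K) ≠ 0 := by norm_num
  have hm : (-1 : K) ≠ 0 := by norm_num
  have e1 : Bits (((0 : K) - (-2)) * (0 - 3)) = (1, 1, 1, 1, 1, 0, 0) := by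
    rw [show ((0 : K) - (-2)) * (0 - 3) = (-1) * (2 * 3) by ring, Bits_mul hm (mul_ne_zero h2 h3),
      Bits_mul h2 h3, m1, m2, m3]; decide
  have e2 : Bits ((0 : K) - (-2)) = (0, 0, 1, 1, 0, 0, 0) := by
    rw [show (0 : K) - (-2) = 2 by ring, m2]
  have e3 : Bits ((-2 : K) - 0) = (1, 1, 1, 1, 0, 0, 0) := by
    rw [show (-2 : K) - 0 = (-1) * 2 by ring, Bits_mul hm h2, m1, m2]; decide
  have e4 : Bits (((-2 : K) - 0) * (-2 - 3)) = (0, 0, 1, 1, 0, 1, 1) := by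
    rw [show ((-2 : K) - 0) * (-2 - 3) = 2 * 5 by ring, Bits_mul h2 h5, m2, m5]; decide
  have e5 : Bits ((3 : K) - 0) = (0, 0, 0, 0, 1, 0, 0) := by rw [sub_zero, m3]
  have e6 : Bits ((3 : K) - (-2)) = (0, 0, 0, 0, 0, 1, 1) := by
    rw [show (3 : K) - (-2) = 5 by ring, m5]
  simp only [coordU, coordW, e1, e2, e3, e4, e5, e6, and_self]

/-- `ψ` at the points with `x = 0` (`T₁`). [folklore] -/
theorem ψ9_x0 {y : K} (hP : (EK).toAffine.Nonsingular 0 y) :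
    ψ9 (.some _ _ hP) = (((1 : ZMod 2), (1 : ZMod 2), (1 : ZMod 2), (1 : ZMod 2), (1 : ZMod 2)),
      ((1 : ZMod 2), (1 : ZMod 2), (0 : ZMod 2), (0 : ZMod 2))) := by
  obtain ⟨c1, c2, -, -, -, -⟩ := coord_torsion
  rw [← c1, ← c2]
  refine ψ9_of_components (by norm_num) (by norm_num) ?_ ?_
  · exact twoDescentComponent_some_of_eq hP rfl
  · exact twoDescentComponent_some_of_ne hP (by norm_num)

/-- `ψ` at the points with `x = -2` (`T₂`). [folklore] -/
theorem ψ9_x2 {y : K} (hP : (EK).toAffine.Nonsingular (-2) y) :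
    ψ9 (.some _ _ hP) = (((1 : ZMod 2), (1 : ZMod 2), (1 : ZMod 2), (1 : ZMod 2), (0 : ZMod 2)),
      ((1 : ZMod 2), (1 : ZMod 2), (1 : ZMod 2), (1 : ZMod 2))) := by
  obtain ⟨-, -, c3, c4, -, -⟩ := coord_torsion
  rw [← c3, ← c4]
  refine ψ9_of_components (by norm_num) (by norm_num) ?_ ?_
  · exact twoDescentComponent_some_of_ne hP (by norm_num)
  · exact twoDescentComponent_some_of_eq hP rfl

/-- `ψ` at the points with `x = 3` (`T₃`). [folklore] -/
theorem ψ9_x3 {y : K} (hP : (EK).toAffine.Nonsingular 3 y) :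
    ψ9 (.some _ _ hP) = (((0 : ZMod 2), (0 : ZMod 2), (0 : ZMod 2), (0 : ZMod 2), (1 : ZMod 2)),
      ((0 : ZMod 2), (0 : ZMod 2), (1 : ZMod 2), (1 : ZMod 2))) := by
  obtain ⟨-, -, -, -, c5, c6⟩ := coord_torsion
  rw [← c5, ← c6]
  refine ψ9_of_components (by norm_num) (by norm_num) ?_ ?_
  · exact twoDescentComponent_some_of_ne hP (by norm_num)
  · exact twoDescentComponent_some_of_ne hP (by norm_num)

/-! ### The main theorem -/

set_option maxHeartbeats 2000000 in
/-- **`rk E(ℚ(√41)) ≤ 1` for `E = 480a1`** — the upper bound `hU41` of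
`descent_480a1_F4_of_upper_bounds`, by a complete `2`-descent over the real quadratic field
`K = ℚ(√41)` (class number one): the coordinates character `ψ9 : E(K) → 𝔽₂⁹` has image in the
`8`-element set `TK` (`cK_coord` off the `2`-torsion, direct evaluation on it) and kernel in `2E(K)`
(a point in the kernel has trivial structural bits for `x` and `x + 2` — the omitted ones vanish by
`point_conditions` — so both are squares by `exists_sq_eq_of_local_data`, and `ker δ = 2E(K)`);
counting by `mordellWeilRank_le_of_range_subset`. Dokchitser–Dokchitser: "2-descent shows that
… `rk E/F₄ = 6` (… over all minimal non-trivial subfields)"; this is the subfield `ℚ(√41)`, where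
`rk E = rk E(ℚ) + rk E^{(41)}(ℚ) = 1 + 0`. [cite: DokchitserDokchitser2011RankModN, proof of Thm. 2] -/
theorem mordellWeilRank_K41_le_one : (EK).mordellWeilRank ≤ 1 := by
  have h := splitTwoTorsion_K
  set T₁ : (EK).toAffine.Point := .some _ _ (nonsingular_twoTorsion h) with hT₁
  set T₂ : (EK).toAffine.Point := .some _ _ (nonsingular_twoTorsion h.swap₁₂) with hT₂
  -- `ψ` on all points lands in `TK`
  have hsub : ∀ P, ψ9 P ∈ TK := by
    intro P
    rw [TK, Finset.mem_filter]
    refine ⟨Finset.mem_univ _, ?_⟩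
    rcases P with _ | ⟨x, y, hP⟩
    · show CK (ψ9 0)
      rw [AddMonoidHom.map_zero]; decide
    · by_cases hx₁ : x = 0
      · subst hx₁; rw [ψ9_x0 hP]; decide
      by_cases hx₂ : x = -2
      · subst hx₂; rw [ψ9_x2 hP]; decide
      by_cases hy : y = 0
      · subst hy
        rcases x_eq_of_y_eq_zero_K hP with h0 | h2 | h3
        · exact absurd h0 hx₁
        · exact absurd h2 hx₂
        · subst h3; rw [ψ9_x3 hP]; decide
      · rw [ψ9_some hP hx₁ hx₂]
        exact cK_coord hP hy
  -- kernel of `ψ` inside `2E(K)`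
  have hker : ∀ P, ψ9 P = 0 → ∃ Q, P = 2 • Q := by
    intro P hP0
    suffices hδ : twoDescentMap h P = 0 by
      have hmem : P ∈ (twoDescentMap h).ker := hδ
      rw [ker_twoDescentMap h] at hmem
      obtain ⟨Q, hQ⟩ := hmem
      exact ⟨Q, hQ.symm⟩
    rcases P with _ | ⟨x, y, hP⟩
    · rfl
    · by_cases hx₁ : x = 0
      · exfalso; subst hx₁
        rw [ψ9_x0 hP] at hP0
        exact absurd hP0 (by decide)
      by_cases hx₂ : x = -2
      · exfalso; subst hx₂
        rw [ψ9_x2 hP] at hP0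
        exact absurd hP0 (by decide)
      have hy : y ≠ 0 := by
        rintro rfl
        rcases x_eq_of_y_eq_zero_K hP with h0 | h0 | h0
        · exact hx₁ h0
        · exact hx₂ h0
        · subst h0; rw [ψ9_x3 hP] at hP0; exact absurd hP0 (by decide)
      rw [ψ9_some hP hx₁ hx₂, Prod.mk_eq_zero] at hP0
      obtain ⟨h1, h2⟩ := hP0
      simp only [coordU, coordW, Bits, Prod.mk_eq_zero] at h1 h2
      obtain ⟨u1, u2, u3, u4, u5⟩ := h1
      obtain ⟨w1, w2, w3, w4⟩ := h2
      have hE := equation_K hP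
      have h₀ : x * (x + 2) * (x - 3) ≠ 0 := hE ▸ pow_ne_zero 2 hy
      have hx : x ≠ 0 := hx₁
      have hx₂' : x + 2 ≠ 0 := fun h0 => h₀ (by rw [h0, mul_zero, zero_mul])
      obtain ⟨hSu, hSw⟩ := hS_point hP hy
      obtain ⟨⟨b1, b2, s1, s2, z3⟩, -, -, -⟩ := point_conditions hP hy
      have hev : ∀ {n : ℤ}, (n : ZMod 2) = 0 → Even n := fun h =>
        even_iff_two_dvd.mpr ((ZMod.intCast_zmod_eq_zero_iff_dvd _ 2).mp h)
      haveI : Fact (Nat.Prime 3) := ⟨Nat.prime_three⟩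
      -- `x` is a square
      obtain ⟨r, hr⟩ := exists_sq_eq_of_local_data hx hSu (hev u3) (hev u4)
        (by have h4 := (inertPlace_parity_eq_zero_iff 3 41 inert_three_data.1 inert_three_data.2 hx).mp u5
            rwa [algNorm_eq_norm])
        (hev b1) (hev b2)
        ((rsign_eq_zero_iff ((map_ne_zero σpos).mpr hx)).mp u1)
        ((rsign_eq_zero_iff ((map_ne_zero σneg).mpr hx)).mp u2)
      -- `x + 2` is a square
      obtain ⟨t, ht⟩ := exists_sq_eq_of_local_data hx₂' hSw (hev w1) (hev w2)
        (by have h4 := (inertPlace_parity_eq_zero_iff 3 41 inert_three_data.1 inert_three_data.2 hx₂').mp z3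
            rwa [algNorm_eq_norm])
        (hev w3) (hev w4)
        ((rsign_eq_zero_iff ((map_ne_zero σpos).mpr hx₂')).mp s1)
        ((rsign_eq_zero_iff ((map_ne_zero σneg).mpr hx₂')).mp s2)
      rw [twoDescentMap_apply, twoDescentComponent_some_of_ne hP hx₁,
        twoDescentComponent_some_of_ne hP hx₂, sub_zero, sub_neg_eq_add,
        (sqClass_eq_one_iff hx).mpr ⟨r, hr⟩, (sqClass_eq_one_iff hx₂').mpr ⟨t, ht⟩]
      rfl
  -- torsion and values
  have hfin₁ : IsOfFinAddOrder T₁ := by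
    refine isOfFinAddOrder_iff_nsmul_eq_zero.mpr ⟨2, two_pos, ?_⟩
    rw [two_nsmul, hT₁]
    exact add_self_of_Y_eq (by simp [WeierstrassCurve.Affine.negY, twoTorsionY, curve480a1])
  have hfin₂ : IsOfFinAddOrder T₂ := by
    refine isOfFinAddOrder_iff_nsmul_eq_zero.mpr ⟨2, two_pos, ?_⟩
    rw [two_nsmul, hT₂]
    exact add_self_of_Y_eq (by simp [WeierstrassCurve.Affine.negY, twoTorsionY, curve480a1])
  have h₁ : ψ9 T₁ ≠ 0 := by rw [hT₁, ψ9_x0]; decide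
  have h₂ : ψ9 T₂ ≠ 0 := by rw [hT₂, ψ9_x2]; decide
  have h₃ : ψ9 (T₁ + T₂) ≠ 0 := by rw [map_add, hT₁, hT₂, ψ9_x0, ψ9_x2]; decide
  have h₁₂ : ψ9 T₁ ≠ ψ9 T₂ := by rw [hT₁, hT₂, ψ9_x0, ψ9_x2]; decide
  have hle := mordellWeilRank_le_of_range_subset ψ9 hker hfin₁ hfin₂ h₁ h₂ h₃ h₁₂ TK hsub
    (r := 1) (by rw [card_TK]; norm_num)
  exact hle

end K41D

/-- **`rk E(ℚ(√41)) ≤ 1` for `E = 480a1`**, restated at the namespace level for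
`descent_480a1_F4_of_upper_bounds` (hypothesis `hU41`).
[cite: DokchitserDokchitser2011RankModN, proof of Thm. 2] -/
theorem mordellWeilRank_480a1_K41_le_one :
    (curve480a1.baseChange Literature.NumberTheory.QuadraticFields.Sqrt41.K).mordellWeilRank ≤ 1 :=
  K41D.mordellWeilRank_K41_le_one

end DokchitserDokchitser2011

end Literature.Barriers.BirchSwinnertonDyer

end
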